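import Summits.QuantumAdvantage.AdviceFreeQNC0.Elimination
import Literature.Computability.MetaComplexity.RazborovSmolenskyPoly
import HarnessLib

/-!
# Razborov's approximation lemma at AND-depth one: ΣΠΣ_𝔽₂ circuits are close to low degree

Cell qa-qnc0 (crux α = `RingToElim`; density axis of planner qa-qnc0-p1's ROUND-12, typed companion
`HOME/qa-qnc0-p1/Sketch13.lean` v3, §"B10"; planner's task L23).  A ΣΠΣ_𝔽₂ circuit
(`MOD₂ ∘ AND ∘ MOD₂`) with `s` AND gates computes an XOR of `s` ANDs of affine forms (`IsSPS s f`).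
Razborov's method, one AND gate at a time — replace `⋀_{ℓ ∈ T} ℓ` by the random degree-`D` gadget
`Π_{j<D} (1 ⊕ ⨁_{ℓ ∈ R_j} (1 ⊕ ℓ))` with independent uniformly random sub-families `R_j ⊆ T` (exact
when the AND is true, wrong with probability exactly `2^{-D}` when it is false), parity gates kept
exact — shows that `f` agrees with a Boolean function of `𝔽₂`-degree `≤ D` outside at most
`s · 2^{n-D}` inputs (average over the choices, fix the best one): Lemma 1 of Razborov 1987 at
AND-depth one; the error per AND gate is `2^{-D}` whatever its fan-in, so size = number of AND gates.
[cite: Razborov1987, Lemma 1] [cite: Smolensky1987, Lemma 1 (the same gadget over 𝔽_p)]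

Main result `spsApprox : SPSApprox`, the statement typed VERBATIM by planner qa-qnc0-p1
(`QaQnc0.Sketch13.SPSApprox`; vocabulary `affEval`, `IsSPS` also verbatim), in the tree's degree
vocabulary `HasDeg` (= the 0/1-indicator lies in `Smolensky.lowDeg (ZMod 2) n D`).  The tree's general
lemma `Smolensky.razborov_smolensky` charges every `acDepth` level including parity levels (degree
`ℓ³` for ΣΠΣ, no per-gate `2^{-D}` count), hence this separate elementary file (LIT-MEMO-17 §4).
Structure: affine forms have degree `≤ 1` (`ind_affEval_mem`); the "even number of false forms in
`R`" test is the affine function `1 + Σ_{ℓ∈R} (1 + [ℓ])` (`ind_evenTest`); the gadget is a product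
of `D` tests (`hasDeg_gadget`), the XOR of the `s` gadgets has degree `≤ D` (`hasDeg_approx`); for a
false AND gate exactly half of the sub-families pass the test (involution `R ↦ R ∆ {ℓ₀}`,
`two_mul_card_even_eq`), so a `2^{-D}` fraction of the choice vectors errs at a given gate and input
(`card_gateErr_mul_le`); exchanging sums, `2^D · Σ_choices #errors ≤ s · 2^n · #choices`, and some
choice is at most average (`spsApprox`).  WHAT THIS IS NOT: not the payoff arithmetic `B10W`/`B10R`
of Sketch13, nothing about `T10W` or α; AND-depth one only (ΣΠΣ_𝔽₂ ⊊ AC⁰[2]), honestly labelled.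
-/


noncomputable section

namespace Summit.QuantumAdvantage.AdviceFreeQNC0

open Finset
open Literature.Computability.MetaComplexity Literature.Computability.MetaComplexity.Smolensky

/-! ### The planner's vocabulary (VERBATIM from `HOME/qa-qnc0-p1/Sketch13.lean` v3) -/

/-- Value of the affine form `(S, b)`: `b ⊕ ⨁_{i ∈ S} x_i`. -/
def affEval {n : ℕ} (ℓ : Finset (Fin n) × Bool) (x : Fin n → Bool) : Bool :=
  xor ℓ.2 (decide ((ℓ.1.filter fun i => x i = true).card % 2 = 1))

/-- `IsSPS s f`: `f` is computed by a ΣΠΣ_𝔽₂ circuit with (at most) `s` AND gates — an XOR of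
`s` ANDs of affine forms (an AND over `∅` is the constant `true`, so affine shifts of the output
are included; unused gates can be padded with a contradictory pair `{ℓ, ¬ℓ}`). -/
def IsSPS {n : ℕ} (s : ℕ) (f : (Fin n → Bool) → Bool) : Prop :=
  ∃ T : Fin s → Finset (Finset (Fin n) × Bool),
    ∀ x, f x = decide ((univ.filter fun i : Fin s => ∀ ℓ ∈ T i, affEval ℓ x = true).card % 2 = 1)

/-- **Razborov 1987, Lemma 1, for AND-depth one**: an XOR of `s` ANDs of affine forms agrees with
some Boolean function of `𝔽₂`-degree `≤ D` outside a set of at most `s · 2^{n-D}` inputs.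
[cite: Razborov1987, Lemma 1] -/
def SPSApprox : Prop :=
  ∀ (n s D : ℕ) (f : (Fin n → Bool) → Bool), IsSPS s f → 1 ≤ D →
    ∃ p : (Fin n → Bool) → Bool, HasDeg p D ∧
      (univ.filter fun x : Fin n → Bool => p x ≠ f x).card * 2 ^ D ≤ s * 2 ^ n

/-! ### The approximating polynomial -/

namespace SPSApprox

variable {n : ℕ}

/-- The `0/1`-indicator of a Boolean function as an element of Smolensky's algebra over `𝔽₂`. -/
def ind (g : (Fin n → Bool) → Bool) : CubeFn (ZMod 2) n := fun x => if g x then 1 else 0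

/-- `HasDeg` is membership of the indicator in the degree filtration (definitional). -/
theorem hasDeg_iff_ind_mem (g : (Fin n → Bool) → Bool) (d : ℕ) :
    HasDeg g d ↔ ind g ∈ lowDeg (ZMod 2) n d := Iff.rfl

/-- A natural number cast to `𝔽₂` is its parity bit. -/
theorem natCast_eq_ite (k : ℕ) : ((k : ℕ) : ZMod 2) = if k % 2 = 1 then 1 else 0 := by
  have h := ZMod.natCast_mod k 2
  rcases Nat.mod_two_eq_zero_or_one k with h0 | h1
  · rw [if_neg (by omega), ← h, h0, Nat.cast_zero]
  · rw [if_pos h1, ← h, h1, Nat.cast_one]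

/-- `[b ⊕ P] = [b] + [P]` in `𝔽₂`. -/
theorem ite_xor_decide (b : Bool) (P : Prop) [Decidable P] :
    (if xor b (decide P) then (1 : ZMod 2) else 0) = (if b then 1 else 0) + (if P then 1 else 0) := by
  by_cases hP : P
  · rw [decide_eq_true hP, if_pos hP]
    cases b <;> decide
  · rw [decide_eq_false hP, if_neg hP]
    cases b <;> decide

/-- The indicator of the affine form `(S, b)` is the affine function `[b] + Σ_{i∈S} x_i`. -/
theorem ind_affEval (ℓ : Finset (Fin n) × Bool) :
    ind (affEval ℓ) = (fun _ => if ℓ.2 then (1 : ZMod 2) else 0) +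
      ∑ i ∈ ℓ.1, (fun x : Fin n → Bool => if x i then (1 : ZMod 2) else 0) := by
  funext x
  rw [Pi.add_apply, Finset.sum_apply, Finset.sum_boole, natCast_eq_ite]
  show (if affEval ℓ x then (1 : ZMod 2) else 0) = _
  have e : affEval ℓ x = xor ℓ.2 (decide ((ℓ.1.filter fun i => x i = true).card % 2 = 1)) := rfl
  rw [e]; exact ite_xor_decide ℓ.2 _

/-- Affine forms have degree `≤ 1`. -/
theorem ind_affEval_mem (ℓ : Finset (Fin n) × Bool) : ind (affEval ℓ) ∈ lowDeg (ZMod 2) n 1 := by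
  rw [ind_affEval]
  refine Submodule.add_mem _ ?_ (Submodule.sum_mem _ fun i _ => bitFn_mem_lowDeg i le_rfl)
  cases ℓ.2
  · have : (fun _ : Fin n → Bool => if false then (1 : ZMod 2) else 0) = 0 := by funext; simp
    rw [this]; exact Submodule.zero_mem _
  · have : (fun _ : Fin n → Bool => if true then (1 : ZMod 2) else 0) = 1 := by funext; simp
    rw [this]; exact one_mem_lowDeg 1

/-- The parity test of one Razborov sub-family `R`: `true` iff an even number of the forms in `R`
are false at `x`. -/
def evenTest (R : Finset (Finset (Fin n) × Bool)) (x : Fin n → Bool) : Bool :=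
  decide ((R.filter fun ℓ => affEval ℓ x = false).card % 2 = 0)

/-- The parity test is the affine function `1 + Σ_{ℓ ∈ R} (1 + [ℓ])`. -/
theorem ind_evenTest (R : Finset (Finset (Fin n) × Bool)) :
    ind (evenTest R) = 1 + ∑ ℓ ∈ R, (1 + ind (affEval ℓ)) := by
  funext x
  rw [Pi.add_apply, Pi.one_apply, Finset.sum_apply]
  show (if evenTest R x then (1 : ZMod 2) else 0) = 1 + ∑ ℓ ∈ R, ((1 : ZMod 2) + ind (affEval ℓ) x)
  have key : ∀ ℓ, ((1 : ZMod 2) + ind (affEval ℓ) x) = if affEval ℓ x = false then 1 else 0 := by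
    intro ℓ
    show ((1 : ZMod 2) + if affEval ℓ x then 1 else 0) = _
    cases affEval ℓ x <;> decide
  rw [Finset.sum_congr rfl fun ℓ _ => key ℓ, Finset.sum_boole, natCast_eq_ite,
    show evenTest R x = decide ((R.filter fun ℓ => affEval ℓ x = false).card % 2 = 0) from rfl]
  rcases Nat.mod_two_eq_zero_or_one ((R.filter fun ℓ => affEval ℓ x = false).card) with h | h
  · rw [decide_eq_true (show (R.filter fun ℓ => affEval ℓ x = false).card % 2 = 0 from h),
      if_pos rfl, if_neg (by omega)]
    decide
  · rw [decide_eq_false (show ¬ (R.filter fun ℓ => affEval ℓ x = false).card % 2 = 0 by omega),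
      if_neg Bool.false_ne_true, if_pos h]
    decide

/-- The parity test has degree `≤ 1`. -/
theorem ind_evenTest_mem (R : Finset (Finset (Fin n) × Bool)) :
    ind (evenTest R) ∈ lowDeg (ZMod 2) n 1 := by
  rw [ind_evenTest]
  exact Submodule.add_mem _ (one_mem_lowDeg 1)
    (Submodule.sum_mem _ fun ℓ _ => Submodule.add_mem _ (one_mem_lowDeg 1) (ind_affEval_mem ℓ))

/-- Razborov's degree-`D` gadget for one AND gate, driven by `D` sub-families `Rj j`. -/
def gadget {D : ℕ} (Rj : Fin D → Finset (Finset (Fin n) × Bool)) (x : Fin n → Bool) : Bool :=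
  decide (∀ j, evenTest (Rj j) x = true)

/-- The gadget is the product of its `D` parity tests. -/
theorem ind_gadget {D : ℕ} (Rj : Fin D → Finset (Finset (Fin n) × Bool)) :
    ind (gadget Rj) = ∏ j, ind (evenTest (Rj j)) := by
  funext x
  rw [Finset.prod_apply]
  show (if gadget Rj x then (1 : ZMod 2) else 0) = ∏ j, (if evenTest (Rj j) x then (1 : ZMod 2) else 0)
  rw [Fintype.prod_boole]
  by_cases h : ∀ j, evenTest (Rj j) x = true
  · rw [show gadget Rj x = true from decide_eq_true h, if_pos rfl, if_pos h]
  · rw [show gadget Rj x = false from decide_eq_false h, if_neg Bool.false_ne_true, if_neg h]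

/-- The gadget has degree `≤ D`. -/
theorem hasDeg_gadget {D : ℕ} (Rj : Fin D → Finset (Finset (Fin n) × Bool)) :
    HasDeg (gadget Rj) D := by
  rw [hasDeg_iff_ind_mem, ind_gadget]
  have h := prod_mem_lowDeg (F := ZMod 2) (n := n) (univ : Finset (Fin D))
    (u := fun j => ind (evenTest (Rj j))) (D := 1) fun j _ => ind_evenTest_mem (Rj j)
  simpa using h

/-- The approximator: XOR of the `s` gadgets. -/
def approx {s D : ℕ} (R : Fin s → Fin D → Finset (Finset (Fin n) × Bool)) (x : Fin n → Bool) : Bool :=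
  decide ((univ.filter fun i : Fin s => gadget (R i) x = true).card % 2 = 1)

/-- The approximator is the sum of the gadgets. -/
theorem ind_approx {s D : ℕ} (R : Fin s → Fin D → Finset (Finset (Fin n) × Bool)) :
    ind (approx R) = ∑ i, ind (gadget (R i)) := by
  funext x
  rw [Finset.sum_apply]
  show (if approx R x then (1 : ZMod 2) else 0) = ∑ i, (if gadget (R i) x then (1 : ZMod 2) else 0)
  rw [Finset.sum_boole, natCast_eq_ite]
  by_cases h : (univ.filter fun i : Fin s => gadget (R i) x = true).card % 2 = 1
  · rw [show approx R x = true from decide_eq_true h, if_pos rfl, if_pos h]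
  · rw [show approx R x = false from decide_eq_false h, if_neg Bool.false_ne_true, if_neg h]

/-- The approximator has degree `≤ D`. -/
theorem hasDeg_approx {s D : ℕ} (R : Fin s → Fin D → Finset (Finset (Fin n) × Bool)) :
    HasDeg (approx R) D := by
  rw [hasDeg_iff_ind_mem, ind_approx]
  exact Submodule.sum_mem _ fun i _ => hasDeg_gadget (R i)

/-! ### Where the approximator can err -/

/-- The AND gate `i` of the circuit `T`. -/
def andGate {s : ℕ} (T : Fin s → Finset (Finset (Fin n) × Bool)) (i : Fin s) (x : Fin n → Bool) :
    Bool :=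
  decide (∀ ℓ ∈ T i, affEval ℓ x = true)

/-- If every gadget agrees with its AND gate at `x`, the approximator agrees with the circuit. -/
theorem approx_eq_of_gadgets {s D : ℕ} (T : Fin s → Finset (Finset (Fin n) × Bool))
    (R : Fin s → Fin D → Finset (Finset (Fin n) × Bool)) (x : Fin n → Bool)
    (h : ∀ i, gadget (R i) x = andGate T i x) :
    approx R x = decide ((univ.filter fun i : Fin s => ∀ ℓ ∈ T i, affEval ℓ x = true).card % 2 = 1) := by
  unfold approx
  have hf : (univ.filter fun i : Fin s => gadget (R i) x = true) =
      univ.filter fun i : Fin s => ∀ ℓ ∈ T i, affEval ℓ x = true := by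
    refine Finset.filter_congr fun i _ => ?_
    rw [h i]; unfold andGate; exact decide_eq_true_iff
  rw [hf]

/-- The space of choice vectors: for every gate `i` and trial `j < D`, a sub-family of `T i`. -/
def choices {s : ℕ} (T : Fin s → Finset (Finset (Fin n) × Bool)) (D : ℕ) :
    Finset (Fin s → Fin D → Finset (Finset (Fin n) × Bool)) :=
  Fintype.piFinset fun i => Fintype.piFinset fun _ : Fin D => (T i).powerset

/-- There is at least one choice vector (all sub-families empty). -/
theorem choices_nonempty {s : ℕ} (T : Fin s → Finset (Finset (Fin n) × Bool)) (D : ℕ) :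
    (choices T D).Nonempty :=
  Fintype.piFinset_nonempty.2 fun i =>
    Fintype.piFinset_nonempty.2 fun _ => ⟨∅, Finset.empty_mem_powerset (T i)⟩

/-- A sub-family of a true AND gate passes the parity test. -/
theorem evenTest_of_andGate {s : ℕ} {T : Fin s → Finset (Finset (Fin n) × Bool)} {i : Fin s}
    {x : Fin n → Bool} (hA : andGate T i x = true) {A : Finset (Finset (Fin n) × Bool)}
    (hAT : A ⊆ T i) : evenTest A x = true := by
  unfold andGate at hA; rw [decide_eq_true_eq] at hA
  unfold evenTest; rw [decide_eq_true_eq]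
  have : (A.filter fun ℓ => affEval ℓ x = false) = ∅ := by
    refine Finset.filter_eq_empty_iff.2 fun ℓ hℓ => ?_
    rw [hA ℓ (hAT hℓ)]; decide
  rw [this, Finset.card_empty]

/-- For a false form `ℓ₀ ∈ U`, toggling `ℓ₀` is an involution of the sub-families of `U` that
flips the parity test; hence exactly half of the sub-families pass it. -/
theorem two_mul_card_even_eq (U : Finset (Finset (Fin n) × Bool)) (x : Fin n → Bool)
    {ℓ₀ : Finset (Fin n) × Bool} (h₀ : ℓ₀ ∈ U) (h₀x : affEval ℓ₀ x = false) :
    2 * (U.powerset.filter fun A => evenTest A x = true).card = 2 ^ U.card := by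
  classical
  let φ : Finset (Finset (Fin n) × Bool) → Finset (Finset (Fin n) × Bool) :=
    fun A => if ℓ₀ ∈ A then A.erase ℓ₀ else insert ℓ₀ A
  have hφφ : Function.Involutive φ := by
    intro A
    by_cases hA : ℓ₀ ∈ A
    · simp only [φ, if_pos hA]
      rw [if_neg (Finset.notMem_erase ℓ₀ A), Finset.insert_erase hA]
    · simp only [φ, if_neg hA]
      rw [if_pos (Finset.mem_insert_self ℓ₀ A), Finset.erase_insert hA]
  have hsub : ∀ A, A ⊆ U ↔ φ A ⊆ U := by
    intro A
    by_cases hA : ℓ₀ ∈ A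
    · simp only [φ, if_pos hA]
      exact (Finset.erase_subset_iff_of_mem h₀).symm
    · simp only [φ, if_neg hA]
      rw [Finset.insert_subset_iff]
      exact ⟨fun h => ⟨h₀, h⟩, fun h => h.2⟩
  have hflip : ∀ A, (A.filter fun ℓ => affEval ℓ x = false).card % 2 = 0 ↔
      ¬ ((φ A).filter fun ℓ => affEval ℓ x = false).card % 2 = 0 := by
    intro A
    by_cases hA : ℓ₀ ∈ A
    · simp only [φ, if_pos hA]
      rw [Finset.filter_erase, Finset.card_erase_of_mem (Finset.mem_filter.2 ⟨hA, h₀x⟩)]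
      have hpos : 0 < (A.filter fun ℓ => affEval ℓ x = false).card :=
        Finset.card_pos.2 ⟨ℓ₀, Finset.mem_filter.2 ⟨hA, h₀x⟩⟩
      omega
    · simp only [φ, if_neg hA]
      rw [Finset.filter_insert, if_pos h₀x,
        Finset.card_insert_of_notMem (fun h => hA (Finset.mem_filter.1 h).1)]
      omega
  have heq : (U.powerset.filter fun A => evenTest A x = true).card =
      (U.powerset.filter fun A => ¬ evenTest A x = true).card := by
    refine Finset.card_equiv (hφφ.toPerm φ) fun A => ?_
    simp only [Function.Involutive.coe_toPerm, Finset.mem_filter, Finset.mem_powerset, evenTest,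
      decide_eq_true_eq]
    rw [← hsub A, hflip A]
  have hsum := Finset.card_filter_add_card_filter_not
    (s := U.powerset) (fun A => evenTest A x = true)
  rw [Finset.card_powerset] at hsum
  omega

/-- At a gate `i` and input `x`, at most a `2^{-D}` fraction of the choice vectors make the gadget
disagree with the AND gate. -/
theorem card_gateErr_mul_le {s : ℕ} (T : Fin s → Finset (Finset (Fin n) × Bool)) (D : ℕ)
    (i : Fin s) (x : Fin n → Bool) :
    ((choices T D).filter fun R => gadget (R i) x ≠ andGate T i x).card * 2 ^ D ≤
      (choices T D).card := by
  classical
  by_cases hA : andGate T i x = true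
  · -- true gate: the gadget is always right
    have : ((choices T D).filter fun R => gadget (R i) x ≠ andGate T i x) = ∅ := by
      refine Finset.filter_eq_empty_iff.2 fun R hR => ?_
      rw [hA, not_ne_iff]
      unfold gadget; rw [decide_eq_true_eq]; intro j
      have hRi : R i ∈ Fintype.piFinset fun _ : Fin D => (T i).powerset :=
        Fintype.mem_piFinset.1 hR i
      exact evenTest_of_andGate hA (Finset.mem_powerset.1 (Fintype.mem_piFinset.1 hRi j))
    rw [this, Finset.card_empty, zero_mul]; exact Nat.zero_le _
  · -- false gate: a false form `ℓ₀ ∈ T i` exists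
    have hA' : andGate T i x = false := by simpa using hA
    have hℓ : ∃ ℓ₀ ∈ T i, affEval ℓ₀ x = false := by
      unfold andGate at hA'
      have h' := of_decide_eq_false hA'
      rw [not_forall] at h'
      obtain ⟨ℓ₀, hℓ₀⟩ := h'
      rw [Classical.not_imp] at hℓ₀
      exact ⟨ℓ₀, hℓ₀.1, (Bool.not_eq_true _).mp hℓ₀.2⟩
    obtain ⟨ℓ₀, h₀, h₀x⟩ := hℓ
    let P : Fin s → Finset (Fin D → Finset (Finset (Fin n) × Bool)) :=
      fun i' => Fintype.piFinset fun _ : Fin D => (T i').powerset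
    let Ev : Finset (Finset (Finset (Fin n) × Bool)) :=
      (T i).powerset.filter fun A => evenTest A x = true
    let G : Finset (Fin D → Finset (Finset (Fin n) × Bool)) := Fintype.piFinset fun _ : Fin D => Ev
    have hGP : G ⊆ P i := by
      intro a ha
      refine Fintype.mem_piFinset.2 fun j => ?_
      exact (Finset.mem_filter.1 (Fintype.mem_piFinset.1 ha j)).1
    have hfilter : ((choices T D).filter fun R => gadget (R i) x ≠ andGate T i x) =
        Fintype.piFinset (Function.update P i G) := by
      rw [Fintype.piFinset_update_eq_filter_piFinset_mem P i hGP]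
      refine Finset.filter_congr fun R hR => ?_
      rw [hA']
      have hRi : R i ∈ P i := Fintype.mem_piFinset.1 hR i
      constructor
      · intro hg
        have hg' : gadget (R i) x = true := by simpa using hg
        unfold gadget at hg'; rw [decide_eq_true_eq] at hg'
        refine Fintype.mem_piFinset.2 fun j => Finset.mem_filter.2 ⟨?_, hg' j⟩
        exact Fintype.mem_piFinset.1 hRi j
      · intro hG
        have : gadget (R i) x = true := by
          unfold gadget; rw [decide_eq_true_eq]
          exact fun j => (Finset.mem_filter.1 (Fintype.mem_piFinset.1 hG j)).2
        rw [this]; decide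
    have hEv : 2 * Ev.card = 2 ^ (T i).card := two_mul_card_even_eq (T i) x h₀ h₀x
    have hG : G.card * 2 ^ D = (P i).card := by
      simp only [G, P, Fintype.card_piFinset_const, Finset.card_powerset]
      rw [← mul_pow, mul_comm, hEv]
    have hΩ : (choices T D).card = (P i).card * ∏ i' ∈ univ \ {i}, (P i').card := by
      unfold choices
      rw [Fintype.card_piFinset]
      exact Finset.prod_eq_mul_prod_sdiff_singleton_of_mem (Finset.mem_univ i) fun i' => (P i').card
    have hrest : ∏ i' ∈ univ \ {i}, (Function.update P i G i').card = ∏ i' ∈ univ \ {i}, (P i').card :=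
      Finset.prod_congr rfl fun i' hi' => by
        have hne : i' ≠ i := fun h => (Finset.mem_sdiff.1 hi').2 (h ▸ Finset.mem_singleton_self i')
        rw [Function.update_of_ne hne]
    rw [hfilter, Fintype.card_piFinset,
      Finset.prod_eq_mul_prod_sdiff_singleton_of_mem (Finset.mem_univ i), Function.update_self, hrest,
      hΩ, ← hG]
    exact le_of_eq (Nat.mul_right_comm _ _ _)

/-! ### The theorem -/

/-- **Razborov's Lemma 1 at AND-depth one** (`SPSApprox`, planner qa-qnc0-p1's Sketch13 v3 verbatim):
every XOR of `s` ANDs of affine forms on `{0,1}ⁿ` agrees with a Boolean function of `𝔽₂`-degree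
`≤ D` outside at most `s · 2^{n-D}` inputs. [cite: Razborov1987, Lemma 1] -/
theorem _root_.Summit.QuantumAdvantage.AdviceFreeQNC0.spsApprox : SPSApprox := by
  classical
  intro n s D f hf _hD
  obtain ⟨T, hT⟩ := hf
  let err : (Fin s → Fin D → Finset (Finset (Fin n) × Bool)) → ℕ :=
    fun R => (univ.filter fun x : Fin n → Bool => approx R x ≠ f x).card
  have h1 : ∀ x : Fin n → Bool, ((choices T D).filter fun R => approx R x ≠ f x).card * 2 ^ D ≤
      s * (choices T D).card := by
    intro x
    have hsub : ((choices T D).filter fun R => approx R x ≠ f x) ⊆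
        (univ : Finset (Fin s)).biUnion fun i =>
          (choices T D).filter fun R => gadget (R i) x ≠ andGate T i x := by
      intro R hR
      rw [Finset.mem_filter] at hR; rw [Finset.mem_biUnion]
      by_contra hcon
      apply hR.2
      rw [hT x]
      refine approx_eq_of_gadgets T R x fun i => ?_
      by_contra hi
      exact hcon ⟨i, Finset.mem_univ i, Finset.mem_filter.2 ⟨hR.1, hi⟩⟩
    calc ((choices T D).filter fun R => approx R x ≠ f x).card * 2 ^ D
        ≤ (∑ i : Fin s, ((choices T D).filter fun R => gadget (R i) x ≠ andGate T i x).card) *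
            2 ^ D := Nat.mul_le_mul_right _ ((Finset.card_le_card hsub).trans Finset.card_biUnion_le)
      _ = ∑ i : Fin s, ((choices T D).filter fun R => gadget (R i) x ≠ andGate T i x).card * 2 ^ D := by
            rw [Finset.sum_mul]
      _ ≤ ∑ _i : Fin s, (choices T D).card := Finset.sum_le_sum fun i _ => card_gateErr_mul_le T D i x
      _ = s * (choices T D).card := by rw [Finset.sum_const, Finset.card_univ, Fintype.card_fin]; rfl
  have h2 : (∑ R ∈ choices T D, err R) * 2 ^ D ≤ 2 ^ n * (s * (choices T D).card) := by
    have hswap : ∑ R ∈ choices T D, err R =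
        ∑ x : Fin n → Bool, ((choices T D).filter fun R => approx R x ≠ f x).card := by
      simp only [err, Finset.card_filter]
      exact Finset.sum_comm
    rw [hswap, Finset.sum_mul]
    calc ∑ x : Fin n → Bool, ((choices T D).filter fun R => approx R x ≠ f x).card * 2 ^ D
        ≤ ∑ _x : Fin n → Bool, s * (choices T D).card := Finset.sum_le_sum fun x _ => h1 x
      _ = 2 ^ n * (s * (choices T D).card) := by
          rw [Finset.sum_const, Finset.card_univ, Fintype.card_fun, Fintype.card_bool,
            Fintype.card_fin]; rfl
  have h3 : ∑ R ∈ choices T D, err R * 2 ^ D ≤ ∑ _R ∈ choices T D, s * 2 ^ n := by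
    rw [← Finset.sum_mul, Finset.sum_const, smul_eq_mul]
    calc (∑ R ∈ choices T D, err R) * 2 ^ D ≤ 2 ^ n * (s * (choices T D).card) := h2
      _ = (choices T D).card * (s * 2 ^ n) := by ring
  obtain ⟨R, _, hR⟩ := Finset.exists_le_of_sum_le (choices_nonempty T D) h3
  exact ⟨approx R, hasDeg_approx R, hR⟩

end SPSApprox

end Summit.QuantumAdvantage.AdviceFreeQNC0
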